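import Mathlib

/-!
# The radius-1 ball around the identity block of `[1 | Z]`

Columns of the `n × (n + m')` matrix `[1 | Z]` are indexed by `Fin (n + m')`: `Fin.castAdd m' i`
(value `i < n`) are the identity columns and `Fin.natAdd n j` (value `n + j`) the `Z`-columns.
An `n`-subset `J` of `Fin (n + m')` with at most one element of value `≥ n` is either the identity
block `Set.range (Fin.castAdd m')`, or the identity block with ONE identity column `Fin.castAdd m' i`
traded for ONE `Z`-column `Fin.natAdd n j`, written as the range of the updated tuple
`Function.update (Fin.castAdd m') i (Fin.natAdd n j)`.  Pure `Finset`/`Fin` combinatorics.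
[folklore]
-/

set_option linter.dupNamespace false

namespace Summit.MatrixMultiplication.MatrixMultiplication.Theorems.CondensationSound

/-- The range of an injective tuple updated at one position `a`: the old value `e a` is traded for
the new value `u`. [folklore] -/
theorem range_update_eq_insert_sdiff_ballShape {α ι : Type*} [DecidableEq α] {e : α → ι}
    (he : Function.Injective e) (a : α) (u : ι) :
    Set.range (Function.update e a u) = insert u (Set.range e \ {e a}) := by
  ext x
  simp only [Set.mem_range, Set.mem_insert_iff, Set.mem_sdiff, Set.mem_singleton_iff]
  constructor
  · rintro ⟨c, rfl⟩
    by_cases hc : c = a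
    · subst hc
      exact Or.inl (Function.update_self _ _ _)
    · rw [Function.update_of_ne hc]
      exact Or.inr ⟨⟨c, rfl⟩, fun h => hc (he h)⟩
  · rintro (rfl | ⟨⟨c, rfl⟩, hne⟩)
    · exact ⟨a, Function.update_self _ _ _⟩
    · refine ⟨c, ?_⟩
      rw [Function.update_of_ne]
      rintro rfl
      exact hne rfl

/-- Membership in the identity block `univ.image (Fin.castAdd m')` is the value bound `x.val < n`.
[folklore] -/
theorem mem_image_castAdd_iff_val_lt_ballShape (n m' : ℕ) (x : Fin (n + m')) :
    x ∈ (Finset.univ : Finset (Fin n)).image (Fin.castAdd m') ↔ x.val < n := by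
  simp only [Finset.mem_image, Finset.mem_univ, true_and]
  constructor
  · rintro ⟨i, rfl⟩
    rw [Fin.val_castAdd]
    exact i.isLt
  · intro hx
    exact ⟨x.castLT hx, Fin.castAdd_castLT m' x hx⟩

/-- **The radius-1 ball around `[n]`** (pure `Finset` combinatorics).  An `n`-subset `J` of
`Fin (n + m')` with at most one element `≥ n` is either the identity block `range (castAdd m')`, or
that block with one identity column `castAdd m' i` traded for one `Z`-column `natAdd n j`, i.e. the
range of the updated tuple `castAdd m' [i ↦ natAdd n j]`.  (Count: the `< n` part of `J` lies in the
`n`-element image of `castAdd`, and `|J| = n`.) [folklore] -/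
theorem stub_ballShape :
    ∀ (n m' : ℕ) (J : Finset (Fin (n + m'))), J.card = n →
      (J.filter fun x : Fin (n + m') => n ≤ x.val).card ≤ 1 →
      (↑J : Set (Fin (n + m'))) = Set.range (Fin.castAdd m' : Fin n → Fin (n + m')) ∨
        ∃ (i : Fin n) (j : Fin m'),
          (↑J : Set (Fin (n + m'))) = Set.range (Function.update (Fin.castAdd m') i (Fin.natAdd n j)) := by
  intro n m' J hJ hball
  -- the identity block as a finset
  set I : Finset (Fin (n + m')) := (Finset.univ : Finset (Fin n)).image (Fin.castAdd m') with hI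
  have hIcard : I.card = n := by
    rw [hI, Finset.card_image_of_injective _ (Fin.castAdd_injective n m'), Finset.card_univ,
      Fintype.card_fin]
  have hIcoe : (↑I : Set (Fin (n + m'))) = Set.range (Fin.castAdd m') := by
    rw [hI, Finset.coe_image, Finset.coe_univ, Set.image_univ]
  -- split `J` into its `≥ n` part `Hi` and its `< n` part `Lo ⊆ I`
  set Hi : Finset (Fin (n + m')) := J.filter fun x : Fin (n + m') => n ≤ x.val with hHi
  set Lo : Finset (Fin (n + m')) := J.filter fun x : Fin (n + m') => ¬ n ≤ x.val with hLo
  have hsplit : Hi.card + Lo.card = n := by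
    rw [hHi, hLo, Finset.card_filter_add_card_filter_not, hJ]
  have hunion : Hi ∪ Lo = J := Finset.filter_union_filter_not_eq _ J
  have hLoI : Lo ⊆ I := by
    intro x hx
    rw [hI, mem_image_castAdd_iff_val_lt_ballShape]
    rw [hLo, Finset.mem_filter] at hx
    omega
  rcases Nat.le_one_iff_eq_zero_or_eq_one.1 hball with h0 | h1
  · -- no `Z`-column: `J = Lo ⊆ I` with `|J| = n = |I|`, so `J = I`
    left
    have hHi0 : Hi = ∅ := Finset.card_eq_zero.1 h0
    have hJLo : Lo = J := by rw [← hunion, hHi0, Finset.empty_union]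
    have hJI : J = I := by
      refine Finset.eq_of_subset_of_card_le (hJLo ▸ hLoI) ?_
      rw [hIcard, hJ]
    rw [hJI, hIcoe]
  · -- exactly one `Z`-column `x₀ = natAdd n j`; the missing identity column is `castAdd m' i`
    right
    obtain ⟨x₀, hx₀⟩ := Finset.card_eq_one.1 h1
    have hx₀mem : x₀ ∈ Hi := by
      rw [hx₀]
      exact Finset.mem_singleton_self _
    have hx₀n : n ≤ x₀.val := by
      rw [hHi, Finset.mem_filter] at hx₀mem
      exact hx₀mem.2
    obtain ⟨j, hj⟩ : ∃ j : Fin m', x₀ = Fin.natAdd n j := ⟨_, (Fin.natAdd_subNat_cast hx₀n).symm⟩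
    have hLocard : Lo.card < I.card := by
      rw [hIcard]
      omega
    obtain ⟨y, hyI, hyLo⟩ := Finset.exists_mem_notMem_of_card_lt_card hLocard
    obtain ⟨i, rfl⟩ : ∃ i : Fin n, Fin.castAdd m' i = y := by
      simpa only [hI, Finset.mem_image, Finset.mem_univ, true_and] using hyI
    refine ⟨i, j, ?_⟩
    have hLoeq : Lo = I.erase (Fin.castAdd m' i) := by
      refine Finset.eq_of_subset_of_card_le ?_ ?_
      · intro x hx
        exact Finset.mem_erase.2 ⟨fun h => hyLo (h ▸ hx), hLoI hx⟩
      · rw [Finset.card_erase_of_mem hyI, hIcard]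
        omega
    rw [range_update_eq_insert_sdiff_ballShape (Fin.castAdd_injective n m'), ← hunion, hx₀, hLoeq,
      Finset.coe_union, Finset.coe_singleton, Finset.coe_erase, hIcoe, hj, Set.singleton_union]

end Summit.MatrixMultiplication.MatrixMultiplication.Theorems.CondensationSound
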